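import Literature.AlgebraicGeometry.AbelianSchemes.PolarizedTripleIsBaseChangeViaZariskiLocal
import Literature.AlgebraicGeometry.AbelianSchemes.PolarizedTripleRigidity
import HarnessLib

/-!
# Chartwise pull-back data of polarised abelian schemes with level structure GLUE (Zariski descent of `(G, Ĝ)`)

Layer `Literature/AlgebraicGeometry/AbelianSchemes`, namespace `Literature.AlgebraicGeometry.AbelianSchemes.PolarizedAbelianSchemeWithLevel`.
THEOREMS ONLY (no definition, no structure, no instance, no named fact, no `sorry`).  Cell `hodgecm-mathlib` (D-0151),
F-DAG hand (h7), sequel (P3) ed. 2 of ★ `PolarizedTripleIsBaseChangeViaZariskiLocal`; consumer F-8 (8c)/(8e) and the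
Zariski twin of (b2′) «the comparison maps `G, Ĝ` descend».  HC_CM is proved only modulo the 7 printed citations until
rung 0 closes; nothing here is about HC.

[MumfordFogartyKirwan1994, Ch. 7 §2 Proposition 7.6 (pp. 136–138)] / [Deligne1971TravauxShimura, 4.16]: for `n ≥ 3`
triples `(X, λ, σ)` are rigid, so the comparison maps of the pull-back relation ★
`PolarizedAbelianSchemeWithLevel.IsBaseChangeVia` are UNIQUE (★ `IsBaseChangeVia.unique_of_forall_geometricPoint`) and
therefore local comparison data GLUE ([GortzWedhorn2020, Section (3.3) Prop. 3.5]).  THIS FILE: over a locally Noetherian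
`T` all of whose geometric points carry rigid triples (the binder `hT` of ★ `PolarizedTripleRigidity`, verbatim), if
`T = ⋃ Uᵢ` is an open cover and for every `i` the restricted triple `P'|_{Uᵢ}` is the pull-back of `P` along
`Uᵢ → T → S` via SOME `(Gᵢ, Ĝᵢ)`, then there are global `G : X' → X`, `Ĝ : X̂' → X̂` restricting to the `(Gᵢ, Ĝᵢ)`
and exhibiting `P'` as the pull-back of `P` along `f`.

* §1 `comp_eq_comp_of_overlap` — pull-back bookkeeping: agreement of `G₁`, `G₂` on the overlap
  `(X' ×_T U₁) ×_{X'} (X' ×_T U₂)` from a comparison map over `U₁ ×_T U₂`.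
* §2 `restrict_comp_eq_of_isBaseChangeVia` — on `Uᵢ ×_T Uⱼ` (locally Noetherian) the two restricted relations have the
  same comparison maps (★ `exists_isBaseChangeVia_id_of_isBaseChangeVia` + ★ `IsBaseChangeVia.unique_of_forall_geometricPoint`), read
  on the overlaps of the covers `X' ×_T Uᵢ` of `X'` and `X̂' ×_T Uᵢ` of `X̂'` (§1).
* §3 **`exists_isBaseChangeVia_of_openCover`** — `G`, `Ĝ` by Mathlib `Scheme.Cover.glueMorphisms`, the relation by ★
  ed. 1 `isBaseChangeVia_of_openCover`.

## References
* [MumfordFogartyKirwan1994] D. Mumford, J. Fogarty, F. Kirwan, *Geometric Invariant Theory*, 3rd ed. (1994), Ch. 7 §2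
  Definition 7.2 (p. 129); Proposition 7.6 (pp. 136–138); §3, remark after Theorem 7.9 (p. 139).
* [Deligne1971TravauxShimura] P. Deligne, *Travaux de Shimura*, Sém. Bourbaki 389 (1971), 4.16 (p. 150).
* [GortzWedhorn2020] U. Görtz, T. Wedhorn, *Algebraic Geometry I*, 2nd ed. (2020), Section (3.3) Proposition 3.5;
  Section (4.7) (pp. 107–108).
-/

noncomputable section

-- the `Over`-category structure maps of ★ `baseChange` are not reducible (as in ★ `PolarizedTripleIsBaseChangeViaZariskiLocal`).
set_option backward.isDefEq.respectTransparency false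

universe u

open CategoryTheory CategoryTheory.Limits AlgebraicGeometry

namespace Literature.AlgebraicGeometry.AbelianSchemes

/-! ### §1 Pull-back bookkeeping on an overlap -/

/-- **Agreement on the overlap from a comparison map over `U₁ ×_T U₂`.**  For `π : X → T`, `uₖ : Uₖ → T`, maps
`Gₖ : X ×_T Uₖ → Y` and a morphism `H : (X ×_T U₂) ×_{U₂} (U₁ ×_T U₂) → (X ×_T U₁) ×_{U₁} (U₁ ×_T U₂)` over `U₁ ×_T U₂`
and over `X` with `H ≫ pr ≫ G₁ = pr ≫ G₂`, the maps `G₁`, `G₂` agree on the overlap `(X ×_T U₁) ×_X (X ×_T U₂)` of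
the open cover `X ×_T Uₖ` of `X` (the overlap maps to `(X ×_T U₂) ×_{U₂} (U₁ ×_T U₂)`).
[cite: GortzWedhorn2020, Section (4.7) (pp. 107–108)] [cite: GortzWedhorn2020, Section (3.3) Proposition 3.5] -/
theorem comp_eq_comp_of_overlap {X Y T U₁ U₂ : Scheme.{u}} (π : X ⟶ T) (u₁ : U₁ ⟶ T) (u₂ : U₂ ⟶ T)
    {G₁ : pullback π u₁ ⟶ Y} {G₂ : pullback π u₂ ⟶ Y}
    (H : pullback (pullback.snd π u₂) (pullback.snd u₁ u₂) ⟶ pullback (pullback.snd π u₁) (pullback.fst u₁ u₂))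
    (hHw : H ≫ pullback.snd (pullback.snd π u₁) (pullback.fst u₁ u₂) =
      pullback.snd (pullback.snd π u₂) (pullback.snd u₁ u₂))
    (hHX : H ≫ pullback.fst (pullback.snd π u₁) (pullback.fst u₁ u₂) ≫ pullback.fst π u₁ =
      pullback.fst (pullback.snd π u₂) (pullback.snd u₁ u₂) ≫ pullback.fst π u₂)
    (hG : H ≫ pullback.fst (pullback.snd π u₁) (pullback.fst u₁ u₂) ≫ G₁ =
      pullback.fst (pullback.snd π u₂) (pullback.snd u₁ u₂) ≫ G₂) :
    pullback.fst (pullback.fst π u₁) (pullback.fst π u₂) ≫ G₁ =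
      pullback.snd (pullback.fst π u₁) (pullback.fst π u₂) ≫ G₂ := by
  -- the overlap `O = (X ×_T U₁) ×_X (X ×_T U₂)` maps to `(X ×_T U₂) ×_{U₂} (U₁ ×_T U₂)`
  have wO : (pullback.fst (pullback.fst π u₁) (pullback.fst π u₂) ≫ pullback.snd π u₁) ≫ u₁ =
      (pullback.snd (pullback.fst π u₁) (pullback.fst π u₂) ≫ pullback.snd π u₂) ≫ u₂ := by
    rw [Category.assoc, Category.assoc, ← pullback.condition, ← pullback.condition, pullback.condition_assoc]
  have wτ : pullback.snd (pullback.fst π u₁) (pullback.fst π u₂) ≫ pullback.snd π u₂ =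
      pullback.lift _ _ wO ≫ pullback.snd u₁ u₂ := by rw [pullback.lift_snd]
  let τ : pullback (pullback.fst π u₁) (pullback.fst π u₂) ⟶ pullback (pullback.snd π u₂) (pullback.snd u₁ u₂) :=
    pullback.lift (pullback.snd _ _) (pullback.lift _ _ wO) wτ
  have hτ₂ : τ ≫ pullback.fst (pullback.snd π u₂) (pullback.snd u₁ u₂) = pullback.snd _ _ := pullback.lift_fst _ _ _
  have hτ₃ : τ ≫ pullback.snd (pullback.snd π u₂) (pullback.snd u₁ u₂) = pullback.lift _ _ wO := pullback.lift_snd _ _ _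
  -- `τ ≫ H ≫ pr = pr₁ : O → X ×_T U₁` (as maps into the pull-back `X ×_T U₁`)
  have hτ₁ : τ ≫ H ≫ pullback.fst (pullback.snd π u₁) (pullback.fst u₁ u₂) = pullback.fst _ _ := by
    apply pullback.hom_ext
    · rw [Category.assoc, Category.assoc, hHX, ← Category.assoc, hτ₂]
      exact pullback.condition.symm
    · rw [Category.assoc, Category.assoc, pullback.condition, ← Category.assoc H, hHw, ← Category.assoc, hτ₃,
        pullback.lift_fst]
  have e : (τ ≫ H ≫ pullback.fst (pullback.snd π u₁) (pullback.fst u₁ u₂)) ≫ G₁ =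
      (τ ≫ pullback.fst (pullback.snd π u₂) (pullback.snd u₁ u₂)) ≫ G₂ := by
    simpa only [Category.assoc] using congrArg (τ ≫ ·) hG
  rw [hτ₁, hτ₂] at e
  exact e

namespace PolarizedAbelianSchemeWithLevel

open AbelianSchemeOver

variable {g N : ℕ} {δ : Fin g → ℕ} {S T : Scheme.{u}} {P' : PolarizedAbelianSchemeWithLevel g N δ T}
  {P : PolarizedAbelianSchemeWithLevel g N δ S} {f : T ⟶ S}

/-! ### §2 The restricted relations agree on `Uᵢ ×_T Uⱼ` -/

/-- **On `U₁ ×_T U₂` two chartwise pull-back data have the same comparison maps** (rigidity): if `(G₁, Ĝ₁)` over `U₁`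
and `(G₂, Ĝ₂)` over `U₂` exhibit `P'|_{U₁}`, `P'|_{U₂}` as pull-backs of `P`, then on the overlaps of the covers
`X' ×_T Uₖ` of `X'` and `X̂' ×_T Uₖ` of `X̂'` they agree: restrict both relations to `U₁ ×_T U₂` (★
`baseChange_isBaseChangeVia`, ★ `IsBaseChangeVia.trans`), compare the two restricted triples by ★
`exists_isBaseChangeVia_id_of_isBaseChangeVia` (both are pull-backs of `P'` along `U₁ ×_T U₂ → T`), and conclude by the
uniqueness of pull-back data over `U₁ ×_T U₂` (assumed locally Noetherian — e.g. `uₖ` open immersions into a locally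
Noetherian `T`, or `u₁ = u₂` an fpqc cover of finite type) with rigid geometric fibres (★
`IsBaseChangeVia.unique_of_forall_geometricPoint`), read on the overlaps by `comp_eq_comp_of_overlap`.
[cite: MumfordFogartyKirwan1994, Ch. 7 §2 Proposition 7.6 (pp. 136–138); §3, remark after Theorem 7.9 (p. 139)]
[cite: Deligne1971TravauxShimura, 4.16 p. 150] [cite: GortzWedhorn2020, Section (3.3) Proposition 3.5] -/
theorem restrict_comp_eq_of_isBaseChangeVia
    (hT : ∀ ⦃Ω : Type u⦄ [Field Ω] [IsAlgClosed Ω] (_t : Spec (.of Ω) ⟶ T)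
      (Q : PolarizedAbelianSchemeWithLevel g N δ (Spec (.of Ω))) (H : Q.A.X.left ⟶ Q.A.X.left)
      (Ĥ : Q.D.hat.X.left ⟶ Q.D.hat.X.left), Q.IsBaseChangeVia Q (𝟙 _) H Ĥ → H = 𝟙 _)
    {U₁ U₂ : Scheme.{u}} (u₁ : U₁ ⟶ T) (u₂ : U₂ ⟶ T) [IsLocallyNoetherian (pullback u₁ u₂)]
    {G₁ : (P'.baseChange u₁).A.X.left ⟶ P.A.X.left} {Ĝ₁ : (P'.baseChange u₁).D.hat.X.left ⟶ P.D.hat.X.left}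
    {G₂ : (P'.baseChange u₂).A.X.left ⟶ P.A.X.left} {Ĝ₂ : (P'.baseChange u₂).D.hat.X.left ⟶ P.D.hat.X.left}
    (h₁ : (P'.baseChange u₁).IsBaseChangeVia P (u₁ ≫ f) G₁ Ĝ₁) (h₂ : (P'.baseChange u₂).IsBaseChangeVia P (u₂ ≫ f) G₂ Ĝ₂) :
    pullback.fst (pullback.fst P'.A.X.hom u₁) (pullback.fst P'.A.X.hom u₂) ≫ G₁ =
        pullback.snd (pullback.fst P'.A.X.hom u₁) (pullback.fst P'.A.X.hom u₂) ≫ G₂ ∧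
      pullback.fst (pullback.fst P'.D.hat.X.hom u₁) (pullback.fst P'.D.hat.X.hom u₂) ≫ Ĝ₁ =
        pullback.snd (pullback.fst P'.D.hat.X.hom u₁) (pullback.fst P'.D.hat.X.hom u₂) ≫ Ĝ₂ := by
  -- the overlap `V = U₁ ×_T U₂` (locally Noetherian) has rigid geometric fibres
  have hV : ∀ ⦃Ω : Type u⦄ [Field Ω] [IsAlgClosed Ω] (_t : Spec (.of Ω) ⟶ pullback u₁ u₂)
      (Q : PolarizedAbelianSchemeWithLevel g N δ (Spec (.of Ω))) (H : Q.A.X.left ⟶ Q.A.X.left)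
      (Ĥ : Q.D.hat.X.left ⟶ Q.D.hat.X.left), Q.IsBaseChangeVia Q (𝟙 _) H Ĥ → H = 𝟙 _ :=
    fun Ω _ _ t => hT (t ≫ pullback.fst u₁ u₂ ≫ u₁)
  -- the two restricted triples `Q₁ = P'|_{U₁}|_V`, `Q₂ = P'|_{U₂}|_V` and their relations with `P` and with `P'`
  have r₁ := (((P'.baseChange u₁).baseChange_isBaseChangeVia (pullback.fst u₁ u₂)).trans h₁)
  have r₂ := (((P'.baseChange u₂).baseChange_isBaseChangeVia (pullback.snd u₁ u₂)).trans h₂)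
  have s₁ := (((P'.baseChange u₁).baseChange_isBaseChangeVia (pullback.fst u₁ u₂)).trans
    (P'.baseChange_isBaseChangeVia u₁))
  have s₂ := (((P'.baseChange u₂).baseChange_isBaseChangeVia (pullback.snd u₁ u₂)).trans
    (P'.baseChange_isBaseChangeVia u₂))
  have hc : pullback.snd u₁ u₂ ≫ u₂ = pullback.fst u₁ u₂ ≫ u₁ := pullback.condition.symm
  have s₂' := (congrArg (fun x => ((P'.baseChange u₂).baseChange (pullback.snd u₁ u₂)).IsBaseChangeVia P' x
    (pullback.fst _ _ ≫ pullback.fst P'.A.X.hom u₂) (pullback.fst _ _ ≫ pullback.fst P'.D.hat.X.hom u₂)) hc).mp s₂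
  -- the comparison `(H, Ĥ) : Q₂ ≅ Q₁` over `V`
  obtain ⟨H, Ĥ, -, -, hHG, hĤG, hK⟩ := s₁.exists_isBaseChangeVia_id_of_isBaseChangeVia s₂'
  -- uniqueness of the pull-back datum of `Q₂` from `P` along `V → S`
  have t₁ := hK.trans r₁
  have hb : 𝟙 _ ≫ pullback.fst u₁ u₂ ≫ u₁ ≫ f = pullback.snd u₁ u₂ ≫ u₂ ≫ f := by
    rw [Category.id_comp, ← Category.assoc, ← hc, Category.assoc]
  have t₁' := (congrArg (fun x => ((P'.baseChange u₂).baseChange (pullback.snd u₁ u₂)).IsBaseChangeVia P x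
    (H ≫ pullback.fst _ _ ≫ G₁) (Ĥ ≫ pullback.fst _ _ ≫ Ĝ₁)) hb).mp t₁
  obtain ⟨eG, eĜ⟩ := IsBaseChangeVia.unique_of_forall_geometricPoint (P := P) hV t₁' r₂
  -- `H`, `Ĥ` lie over `V` and over `X'`, `X̂'`
  obtain ⟨wH, -⟩ := hK.1.1
  obtain ⟨wĤ, -⟩ := hK.2.1
  rw [Category.comp_id] at wH wĤ
  refine ⟨comp_eq_comp_of_overlap P'.A.X.hom u₁ u₂ H wH ?_ eG, comp_eq_comp_of_overlap P'.D.hat.X.hom u₁ u₂ Ĥ wĤ ?_ eĜ⟩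
  · rw [← Category.assoc]; exact hHG
  · rw [← Category.assoc]; exact hĤG

/-! ### §3 Gluing the chartwise comparison maps -/

/-- **CHARTWISE PULL-BACK DATA GLUE** ([MumfordFogartyKirwan1994] Prop. 7.6: for `n ≥ 3` the local isomorphisms of
triples are unique, hence glue; [GortzWedhorn2020] Prop. 3.5).  Over a locally Noetherian `T` whose geometric points carry
rigid triples: if for an open cover `T = ⋃ Uᵢ` each restricted triple `P'|_{Uᵢ}` (★ `baseChange (𝒰.f i)`) is the
pull-back of `P` along `Uᵢ → T → S` via some `(Gᵢ, Ĝᵢ)`, then there are `G : X' → X`, `Ĝ : X̂' → X̂` with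
`(X' ×_T Uᵢ → X') ≫ G = Gᵢ`, `(X̂' ×_T Uᵢ → X̂') ≫ Ĝ = Ĝᵢ` (Mathlib `Scheme.Cover.glueMorphisms` on the covers
`X' ×_T Uᵢ`, `X̂' ×_T Uᵢ`; agreement on overlaps §2) exhibiting `P'` as the pull-back of `P` along `f` (★ ed. 1
`isBaseChangeVia_of_openCover`). [cite: MumfordFogartyKirwan1994, Ch. 7 §2 Proposition 7.6 (pp. 136–138)]
[cite: MumfordFogartyKirwan1994, Ch. 7 §2 Definition 7.2 (p. 129)] [cite: GortzWedhorn2020, Section (3.3) Proposition 3.5]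
[cite: Deligne1971TravauxShimura, 4.16 p. 150] -/
theorem exists_isBaseChangeVia_of_openCover [IsLocallyNoetherian T]
    (hT : ∀ ⦃Ω : Type u⦄ [Field Ω] [IsAlgClosed Ω] (_t : Spec (.of Ω) ⟶ T)
      (Q : PolarizedAbelianSchemeWithLevel g N δ (Spec (.of Ω))) (H : Q.A.X.left ⟶ Q.A.X.left)
      (Ĥ : Q.D.hat.X.left ⟶ Q.D.hat.X.left), Q.IsBaseChangeVia Q (𝟙 _) H Ĥ → H = 𝟙 _)
    (𝒰 : Scheme.OpenCover.{u} T) (Gc : ∀ i, (P'.baseChange (𝒰.f i)).A.X.left ⟶ P.A.X.left)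
    (Ĝc : ∀ i, (P'.baseChange (𝒰.f i)).D.hat.X.left ⟶ P.D.hat.X.left)
    (h : ∀ i, (P'.baseChange (𝒰.f i)).IsBaseChangeVia P (𝒰.f i ≫ f) (Gc i) (Ĝc i)) :
    ∃ (G : P'.A.X.left ⟶ P.A.X.left) (Ĝ : P'.D.hat.X.left ⟶ P.D.hat.X.left),
      (∀ i, pullback.fst P'.A.X.hom (𝒰.f i) ≫ G = Gc i) ∧ (∀ i, pullback.fst P'.D.hat.X.hom (𝒰.f i) ≫ Ĝ = Ĝc i) ∧
        P'.IsBaseChangeVia P f G Ĝ := by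
  haveI : ∀ i j, IsLocallyNoetherian (pullback (𝒰.f i) (𝒰.f j)) := fun i j =>
    isLocallyNoetherian_of_isOpenImmersion (pullback.snd (𝒰.f i) (𝒰.f j) ≫ 𝒰.f j)
  have hagree := fun i j => restrict_comp_eq_of_isBaseChangeVia (P := P) hT (𝒰.f i) (𝒰.f j) (h i) (h j)
  let G : P'.A.X.left ⟶ P.A.X.left :=
    Scheme.Cover.glueMorphisms (𝒰.pullback₁ P'.A.X.hom) (fun i => Gc i) fun i j => (hagree i j).1
  let Ĝ : P'.D.hat.X.left ⟶ P.D.hat.X.left :=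
    Scheme.Cover.glueMorphisms (𝒰.pullback₁ P'.D.hat.X.hom) (fun i => Ĝc i) fun i j => (hagree i j).2
  have hG : ∀ i, pullback.fst P'.A.X.hom (𝒰.f i) ≫ G = Gc i := fun i =>
    Scheme.Cover.ι_glueMorphisms (𝒰.pullback₁ P'.A.X.hom) (fun i => Gc i) (fun i j => (hagree i j).1) i
  have hĜ : ∀ i, pullback.fst P'.D.hat.X.hom (𝒰.f i) ≫ Ĝ = Ĝc i := fun i =>
    Scheme.Cover.ι_glueMorphisms (𝒰.pullback₁ P'.D.hat.X.hom) (fun i => Ĝc i) (fun i j => (hagree i j).2) i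
  refine ⟨G, Ĝ, hG, hĜ, isBaseChangeVia_of_openCover 𝒰 fun i => ?_⟩
  rw [hG i, hĜ i]
  exact h i

end PolarizedAbelianSchemeWithLevel

end Literature.AlgebraicGeometry.AbelianSchemes

end
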